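import Literature.MathematicalPhysics.KineticTheory.DiPernaLionsStabilityProofs
import Literature.MathematicalPhysics.KineticTheory.DiPernaLionsExpSupersolution
import HarnessLib

/-!
# Discharged fact: the DiPerna–Lions theorem (`diperna_lions`, hilbert6.S11) holds

`Literature.MathematicalPhysics.KineticTheory.diperna_lions` (`KineticTheory/BoltzmannSolutions`:
global renormalised solutions of the Boltzmann equation for large data with finite mass, energy
and entropy — DiPerna–Lions, Ann. of Math. 130 (1989), Thm. 1 (i)–(iii); Cercignani–Illner–
Pulvirenti 1994, Thm. 5.3.5) was reduced in the tree to its two published halves by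
`diperna_lions_of_approximatingScheme_of_weakStability` (`KineticTheory/DiPernaLionsStability`):
the approximating scheme (A) `diPernaLions_approximatingScheme` (CIP Lemma 5.3.6 + Step 7) and the
weak stability theorem (B) `diPernaLions_weakStability` (CIP Steps 8–14).  Both halves are theorems
of the tree — `diPernaLions_approximatingScheme_holds` (`KineticTheory/DiPernaLionsStabilityProofs`)
and `diPernaLions_weakStability_holds` (`KineticTheory/DiPernaLionsExpSupersolution`) — so the fact
is discharged by the one-line assembly below.  No statement is changed; no definition, no new
named fact (D-0026); net Literature debt **−1**.

## References

* R. J. DiPerna, P.-L. Lions, *On the Cauchy problem for Boltzmann equations: global existence and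
  weak stability*, Ann. of Math. 130 (1989) 321–366, Theorem p. 322. [DiPernaLionsAnnals1989]
* C. Cercignani, R. Illner, M. Pulvirenti, *The Mathematical Theory of Dilute Gases*, Springer
  (1994), §5.3, Thm. 5.3.5 (p. 144) with its proof, Steps 6–14 (pp. 145–160). [CIPDiluteGases1994]
-/

noncomputable section

namespace Literature.MathematicalPhysics.KineticTheory

universe u

variable {E : Type u} [NormedAddCommGroup E] [InnerProductSpace ℝ E] [FiniteDimensional ℝ E]
  [MeasurableSpace E] [BorelSpace E]

/-- **The DiPerna–Lions theorem (hilbert6.S11) — the named fact `diperna_lions` holds**: for a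
DiPerna–Lions collision kernel `B` and data `f₀ ≥ 0` with finite mass, second moments and entropy
there is a global renormalised solution `f` with `f(0) = f₀`, the mass–moment–entropy bound on
bounded time intervals, conservation of mass and the entropy inequality
(`diperna_lions_of_approximatingScheme_of_weakStability` applied to
`diPernaLions_approximatingScheme_holds` and `diPernaLions_weakStability_holds`).
[cite: DiPernaLionsAnnals1989, Theorem p. 322 (Thm. 1 (i)–(iii))]
[cite: CIPDiluteGases1994, §5.3 Thm 5.3.5 (p. 144; proof = Steps 6–14)] -/
theorem diperna_lions_holds : diperna_lions (E := E) :=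
  diperna_lions_of_approximatingScheme_of_weakStability diPernaLions_approximatingScheme_holds
    diPernaLions_weakStability_holds

end Literature.MathematicalPhysics.KineticTheory

end
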